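import Literature.Probability.LatticeModels.InterfaceTouching
import Literature.Probability.LatticeModels.LevelTransport
import HarnessLib

/-!
# Shift lemma, geometric part: a `-∗`semicircuit above a finite `+`hull (GH2000, Lemma 3.4)

Topic `Probability/LatticeModels`. Georgii–Higuchi 2000, proof of the shift lemma (Lemma 3.4,
p. 1157): "for any `n ≥ 1` [there is a] `-∗`semicircuit `σ_n` in `π̃ = {x₂ ≥ 1}` containing `Λ_n`
in its interior … Let `x_n ∈ ℓ_left` and `y_n ∈ ℓ_right` be the two points of `ℓ` facing the endpoints
of `σ_n` … if the spins at `x_n` and `y_n` take value `-1` [then] the box `[-n, n] × [0, n - 1]`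
is surrounded by a `-∗`semicircuit in `π_up`", and then no infinite `+`cluster of `π_up` meets
the box.

We give the contour-free (Timár) rendition used by this formalisation.

* `exists_starWalk_boundary_halfPlane` — for a finite lattice-connected set `F` of the upper
  half-plane meeting the axis, whose lattice neighbours in the upper half-plane lie in a set
  `M`, and the two canonical axis sites `(a, 0)`, `(b, 0)` "facing `F`" from the left and from
  the right, there is a `∗`-walk of `M`-sites of the upper half-plane outside `F` from `(a, 0)`
  to `(b, 0)` (Timár's boundary-connectivity theorem for `F ∪ R(F)` and the fold `(u, v) ↦
  (u, |v|)`, as in `InterfaceTouching.lean`);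
* `exists_starWalk_boundary_level_one` — the same one level up (`F ⊆ {x₂ ≥ 1}` meeting `ℓ₁`);
* `siteCluster_finite_of_minusStarWalk` — a `-∗`walk of `π_up` from `(a, 0)`, `a < -n`, to
  `(b, 0)`, `b > n`, avoiding `[-n, n] × {x₂ ≤ n + 1}` forces every `+`cluster of `π_up` through
  `[-n, n] × [0, n + 1]` to be finite (eye/band lemma `exists_mem_support_of_bandSemicircuits`).

## References

* H.-O. Georgii, Y. Higuchi, *Percolation and number of phases in the two-dimensional Ising
  model*, J. Math. Phys. 41 (2000), Lemma 3.4 [GeorgiiHiguchi2000].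
* Á. Timár, *Boundary-connectivity via graph theory*, PAMS 141 (2013) [Timar2013].
-/

noncomputable section

open MeasureTheory Filter SimpleGraph
open Literature.Probability.Percolation
open scoped ENNReal

namespace Literature.Probability.LatticeModels

section Geometry

/-- **A `∗`-walk in the boundary of a finite set of the upper half-plane between its two facing
axis sites** (Timár's theorem applied to `F ∪ R(F)` and folded into `π_up`): cf. Georgii–Higuchi
2000, proof of Lemma 3.4, the `-∗`semicircuit `σ_n` and "the two points of `ℓ` facing the
endpoints of `σ_n`". [cite: GeorgiiHiguchi2000, Lemma 3.4 (proof)] -/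
theorem exists_starWalk_boundary_halfPlane (F : Finset (Site 2)) (M : Set (Site 2))
    (hFH : ∀ z ∈ F, 0 ≤ z 1) (hF0 : ∃ z ∈ F, z 1 = 0)
    (hconn : ∀ u ∈ F, ∀ v ∈ F, ∃ q : (zdGraph 2).Walk u v, ∀ z ∈ q.support, z ∈ F)
    (hclosed : ∀ v : Site 2, 0 ≤ v 1 → v ∉ F → (∃ c ∈ F, (zdGraph 2).Adj v c) → v ∈ M)
    {a b : ℤ}
    (ha0 : ∀ t ≤ a, (![t, 0] : Site 2) ∉ F) (ha1 : ∀ t < a, (![t, 1] : Site 2) ∉ F)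
    (ha : ∃ c ∈ F, (zdGraph 2).Adj (![a, 0] : Site 2) c)
    (hb0 : ∀ t, b ≤ t → (![t, 0] : Site 2) ∉ F) (hb1 : ∀ t, b < t → (![t, 1] : Site 2) ∉ F)
    (hb : ∃ c ∈ F, (zdGraph 2).Adj (![b, 0] : Site 2) c) :
    ∃ q : zdStarGraph.Walk (![a, 0] : Site 2) ![b, 0], ∀ v ∈ q.support, 0 ≤ v 1 ∧ v ∉ F ∧ v ∈ M := by
  classical
  -- the symmetrised finite set `C = F ∪ R(F)`
  set C : Finset (Site 2) := F ∪ F.image Rf with hCdef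
  have hmemC : ∀ z, z ∈ C ↔ z ∈ F ∨ Rf z ∈ F := fun z => by
    rw [hCdef, Finset.mem_union, Finset.mem_image]
    constructor
    · rintro (h | ⟨y, hy, rfl⟩)
      · exact Or.inl h
      · right; rw [Rf_Rf]; exact hy
    · rintro (h | h)
      · exact Or.inl h
      · exact Or.inr ⟨Rf z, h, Rf_Rf z⟩
  have hC_symm : ∀ z, Rf z ∈ C ↔ z ∈ C := fun z => by rw [hmemC, hmemC, Rf_Rf]; tauto
  have hFC : ∀ z ∈ F, z ∈ C := fun z hz => (hmemC z).2 (Or.inl hz)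
  have hFsub : (↑F : Set (Site 2)) ⊆ halfPlane 0 := fun z hz => hFH z hz
  -- lattice neighbours of `C` in the upper half-plane outside `C` lie in `M`
  have hbdry : ∀ {v : Site 2}, 0 ≤ v 1 → v ∉ C → (∃ c ∈ C, (zdGraph 2).Adj v c) → v ∈ M ∧ v ∉ F := by
    rintro v hv1 hvC ⟨c, hc, hvc⟩
    obtain ⟨c', hc', hvc'⟩ := exists_adj_of_adj_union_reflect hFsub hv1 ((hmemC c).1 hc) hvc
    exact ⟨hclosed v hv1 (fun h => hvC (hFC v h)) ⟨c', hc', hvc'⟩, fun h => hvC (hFC v h)⟩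
  -- which sites near the axis belong to `C`
  have haxisC : ∀ t : ℤ, (![t, 0] : Site 2) ∈ C ↔ (![t, 0] : Site 2) ∈ F := fun t => by
    rw [hmemC, show Rf (![t, 0] : Site 2) = ![t, 0] from reflectCoord_one_eq_self_of_apply_one (by simp),
      or_self]
  have hRf_down : ∀ t : ℤ, Rf (![t, -1] : Site 2) = ![t, 1] := fun t => by
    rw [Site.eq_iff_two, Rf_apply_zero, Rf_apply_one]; simp
  have hupC : ∀ t : ℤ, (![t, 1] : Site 2) ∈ C ↔ (![t, 1] : Site 2) ∈ F := fun t => by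
    rw [hmemC, or_iff_left]
    intro h
    have := hFH _ h
    rw [Rf_apply_one] at this
    simp at this
  have hdownC : ∀ t : ℤ, (![t, -1] : Site 2) ∈ C ↔ (![t, 1] : Site 2) ∈ F := fun t => by
    rw [hmemC, hRf_down, or_iff_right]
    intro h; have := hFH _ h; simp at this
  -- a site `(t, 0)` adjacent to `C` has `(t ± 1, 0) ∈ F` or `(t, 1) ∈ F`
  have hadjC : ∀ (t : ℤ) (c : Site 2), c ∈ C → (zdGraph 2).Adj (![t, 0] : Site 2) c →
      (![t + 1, 0] : Site 2) ∈ F ∨ (![t - 1, 0] : Site 2) ∈ F ∨ (![t, 1] : Site 2) ∈ F := by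
    intro t c hc hadj
    rcases (zdGraph_two_adj_iff _ c).1 hadj with ⟨h0, h1⟩ | ⟨h0, h1⟩ | ⟨h1, h0⟩ | ⟨h1, h0⟩ <;>
      simp only [Matrix.cons_val_zero, Matrix.cons_val_one] at h0 h1
    · left
      have : c = ![t + 1, 0] := by rw [Site.eq_iff_two]; simp; omega
      rw [← haxisC, ← this]; exact hc
    · right; left
      have : c = ![t - 1, 0] := by rw [Site.eq_iff_two]; simp; omega
      rw [← haxisC, ← this]; exact hc
    · right; right
      have : c = ![t, 1] := by rw [Site.eq_iff_two]; simp; omega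
      rw [← hupC, ← this]; exact hc
    · right; right
      have : c = ![t, -1] := by rw [Site.eq_iff_two]; simp; omega
      rw [← hdownC, ← this]; exact hc
  have hnoadjL : ∀ t < a, ∀ c ∈ C, ¬ (zdGraph 2).Adj (![t, 0] : Site 2) c := by
    intro t ht c hc hadj
    rcases hadjC t c hc hadj with h | h | h
    · exact ha0 (t + 1) (by omega) h
    · exact ha0 (t - 1) (by omega) h
    · exact ha1 t ht h
  have hnoadjR : ∀ t, b < t → ∀ c ∈ C, ¬ (zdGraph 2).Adj (![t, 0] : Site 2) c := by
    intro t ht c hc hadj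
    rcases hadjC t c hc hadj with h | h | h
    · exact hb0 (t + 1) (by omega) h
    · exact hb0 (t - 1) (by omega) h
    · exact hb1 t ht h
  -- a box around `C`, the far axis site `x₀ = (-M, 0)` and the ring through it
  obtain ⟨H, hH⟩ := (eventually_subset_box_holds (d := 2) C).exists
  set M₀ : ℕ := H + 2 with hM₀
  set x₀ : Site 2 := ![-(M₀ : ℤ), 0] with hx₀
  have hx₀H : x₀ ∉ box 2 (H + 1) := by
    rw [mem_box, Fin.forall_fin_two]; simp [hx₀, hM₀]
  have hx₀C : x₀ ∉ C := fun h => hx₀H (box_mono 2 (Nat.le_succ H) (hH h))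
  have hx₀adj : ∀ c ∈ C, ¬ (zdGraph 2).Adj x₀ c := fun c hc h => hx₀H (mem_box_succ_of_zdAdj (hH hc) h)
  have hx₀ring : OnRing M₀ x₀ := by unfold OnRing; left; simp [hx₀]
  have hab_box : ∀ {t : ℤ} {c : Site 2}, c ∈ C → (zdGraph 2).Adj (![t, 0] : Site 2) c → -(M₀ : ℤ) < t ∧ t < M₀ := by
    intro t c hc hadj
    have := mem_box_succ_of_zdAdj (hH hc) hadj
    rw [mem_box, Fin.forall_fin_two] at this
    simp at this; omega
  obtain ⟨cL, hcLF, hadjL⟩ := ha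
  obtain ⟨cR, hcRF, hadjR⟩ := hb
  have haM : -(M₀ : ℤ) < a ∧ a < M₀ := hab_box (hFC _ hcLF) hadjL
  have hbM : -(M₀ : ℤ) < b ∧ b < M₀ := hab_box (hFC _ hcRF) hadjR
  -- the outer-visible site on the left: along the axis from `x₀`
  set sR : Site 2 := Pi.single 0 1 with hsR
  set kL : ℕ := (a + M₀).toNat with hkL
  set runL := Zhang.stepRun sR Zhang.adj_add_unitStep.1 x₀ kL with hrunL
  have hendL : ((fun w : Site 2 => w + sR)^[kL] x₀) = ![a, 0] := by
    rw [Site.eq_iff_two, Zhang.iterate_add_apply, Zhang.iterate_add_apply]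
    simp [hsR, hx₀]; omega
  obtain ⟨zL, hzLw, hzLout, -⟩ := exists_mem_LOutVis_of_walk hx₀C (hFC _ hcLF) ((runL.copy rfl hendL).concat hadjL)
  have hzL : zL = ![a, 0] := by
    have hzLC : zL ∉ C := hzLout.1.1
    obtain ⟨c, hc, hzLc⟩ := hzLout.1.2.1
    rw [Walk.support_concat, List.mem_append, List.mem_singleton, Walk.support_copy] at hzLw
    rcases hzLw with hzLw | rfl
    · obtain ⟨j, hj, hj0, hj1⟩ := Zhang.mem_support_stepRun.1 hzLw
      simp only [hsR, hx₀] at hj0 hj1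
      simp at hj0 hj1
      have hzLeq : zL = ![zL 0, 0] := eq_axis_of_apply_one hj1
      have hle : zL 0 ≤ a := by
        have : (j : ℤ) ≤ kL := by exact_mod_cast hj
        omega
      rcases hle.lt_or_eq with hlt | heq
      · exact absurd hzLc (by rw [hzLeq]; exact hnoadjL _ hlt c hc)
      · rw [hzLeq, heq]
    · exact absurd (hFC _ hcLF) hzLC
  rw [hzL] at hzLout
  -- the outer-visible site on the right: around the ring and back along the axis
  obtain ⟨ρ, hρ⟩ := exists_walk_onRing hx₀ring (onRing_axis M₀)
  set sL : Site 2 := -Pi.single 0 1 with hsL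
  set kR : ℕ := ((M₀ : ℤ) - b).toNat with hkR
  set runR := Zhang.stepRun sL Zhang.adj_add_unitStep.2.1 (![(M₀ : ℤ), 0]) kR with hrunR
  have hendR : ((fun w : Site 2 => w + sL)^[kR] (![(M₀ : ℤ), 0] : Site 2)) = ![b, 0] := by
    rw [Site.eq_iff_two, Zhang.iterate_add_apply, Zhang.iterate_add_apply]
    simp [hsL]; omega
  obtain ⟨zR, hzRw, hzRout, -⟩ :=
    exists_mem_LOutVis_of_walk hx₀C (hFC _ hcRF) ((ρ.append (runR.copy rfl hendR)).concat hadjR)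
  have hzR : zR = ![b, 0] := by
    have hzRC : zR ∉ C := hzRout.1.1
    obtain ⟨c, hc, hzRc⟩ := hzRout.1.2.1
    have hzR_not_ring : ¬ OnRing M₀ zR := fun h =>
      not_mem_box_of_onRing (by omega) h (mem_box_succ_of_zdAdj (hH hc) hzRc)
    rw [Walk.support_concat, List.mem_append, List.mem_singleton, Walk.support_append, List.mem_append,
      Walk.support_copy] at hzRw
    rcases hzRw with (hzRw | hzRw) | rfl
    · exact absurd (hρ zR hzRw) hzR_not_ring
    · obtain ⟨j, hj, hj0, hj1⟩ := Zhang.mem_support_stepRun.1 (List.mem_of_mem_tail hzRw)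
      simp only [hsL] at hj0 hj1
      simp at hj0 hj1
      have hzReq : zR = ![zR 0, 0] := eq_axis_of_apply_one hj1
      have hle : b ≤ zR 0 := by
        have : (j : ℤ) ≤ kR := by exact_mod_cast hj
        omega
      rcases hle.lt_or_eq with hlt | heq
      · exact absurd hzRc (by rw [hzReq]; exact hnoadjR _ hlt c hc)
      · rw [hzReq, ← heq]
    · exact absurd (hFC _ hcRF) hzRC
  rw [hzR] at hzRout
  -- `C` is lattice-connected (through an axis site of `F`)
  obtain ⟨z₀, hz₀F, hz₀⟩ := hF0
  have hz₀R : Rf z₀ = z₀ := reflectCoord_one_eq_self_of_apply_one hz₀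
  have hRconn : ∀ u v : Site 2, Rf u ∈ F → Rf v ∈ F → ∃ q : (zdGraph 2).Walk u v, ∀ z ∈ q.support, Rf z ∈ F := by
    intro u v hu hv
    obtain ⟨q, hq⟩ := hconn _ hu _ hv
    refine ⟨(q.map (reflectCoord (d := 2) 1).toRelEmbedding.toRelHom).copy (Rf_Rf u) (Rf_Rf v), fun z hz => ?_⟩
    rw [Walk.support_copy, Walk.support_map, List.mem_map] at hz
    obtain ⟨y, hy, rfl⟩ := hz
    show Rf (Rf y) ∈ F
    rw [Rf_Rf]; exact hq y hy
  have hCconn : ∀ u ∈ C, ∀ v ∈ C, ∃ q : (zdGraph 2).Walk u v, ∀ z ∈ q.support, z ∈ C := by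
    have toZ : ∀ u ∈ C, ∃ q : (zdGraph 2).Walk u z₀, ∀ z ∈ q.support, z ∈ C := by
      intro u hu
      rcases (hmemC u).1 hu with hu | hu
      · obtain ⟨q, hq⟩ := hconn u hu _ hz₀F
        exact ⟨q, fun z hz => (hmemC z).2 (Or.inl (hq z hz))⟩
      · obtain ⟨q, hq⟩ := hRconn u z₀ hu (by rw [hz₀R]; exact hz₀F)
        exact ⟨q, fun z hz => (hmemC z).2 (Or.inr (hq z hz))⟩
    intro u hu v hv
    obtain ⟨q₁, hq₁⟩ := toZ u hu
    obtain ⟨q₂, hq₂⟩ := toZ v hv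
    refine ⟨q₁.append q₂.reverse, fun z hz => ?_⟩
    rw [Walk.support_append, List.mem_append, Walk.support_reverse] at hz
    rcases hz with hz | hz
    · exact hq₁ z hz
    · exact hq₂ z (List.mem_reverse.1 (List.mem_of_mem_tail hz))
  -- Timár: a `∗`-walk in the outer-visible boundary from `(a, 0)` to `(b, 0)`; fold it into `π_up`
  obtain ⟨q, hq⟩ := exists_starWalk_latticeBoundary hCconn hx₀C hx₀adj hzLout hzRout
  have hfold : ∀ v ∈ q.support, 0 ≤ (foldSite v) 1 ∧ foldSite v ∉ F ∧ foldSite v ∈ M := by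
    intro v hv
    have hvout := hq v hv
    have hvC : v ∉ C := hvout.1.1
    obtain ⟨c, hc, hvc⟩ := hvout.1.2.1
    have hv1 : 0 ≤ (foldSite v) 1 := by rw [foldSite_apply_one]; exact abs_nonneg _
    refine ⟨hv1, ?_⟩
    rcases foldSite_eq_or v with h | h
    · rw [h] at hv1 ⊢
      have := hbdry hv1 hvC ⟨c, hc, hvc⟩
      exact ⟨this.2, this.1⟩
    · rw [h] at hv1 ⊢
      have := hbdry hv1 (fun h' => hvC ((hC_symm v).1 h')) ⟨Rf c, (hC_symm c).2 hc,
        ((reflectCoord (d := 2) 1).map_adj_iff).2 hvc⟩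
      exact ⟨this.2, this.1⟩
  refine ⟨(q.map starFoldHom).copy (foldSite_of_nonneg (show (0 : ℤ) ≤ (![a, 0] : Site 2) 1 by simp))
    (foldSite_of_nonneg (show (0 : ℤ) ≤ (![b, 0] : Site 2) 1 by simp)), fun v hv => ?_⟩
  rw [Walk.support_copy, Walk.support_map, List.mem_map] at hv
  obtain ⟨y, hy, rfl⟩ := hv
  exact hfold y hy

/-- Membership in a shifted finite set. [folklore] -/
theorem mem_image_sub_iff (F : Finset (Site 2)) (e z : Site 2) [DecidableEq (Site 2)] :
    z ∈ F.image (fun y => y - e) ↔ z + e ∈ F := by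
  rw [Finset.mem_image]
  constructor
  · rintro ⟨y, hy, rfl⟩; rwa [sub_add_cancel]
  · intro h; exact ⟨z + e, h, add_sub_cancel_right z e⟩

/-- **The same one level up**: for a finite lattice-connected `F ⊆ {x₂ ≥ 1}` meeting `ℓ₁ = {x₂ = 1}`
whose lattice neighbours in `{x₂ ≥ 1}` lie in `M`, a `∗`-walk of `M`-sites of `{x₂ ≥ 1} ∖ F` joins
the two sites of `ℓ₁` facing `F` (Georgii–Higuchi's `σ_n ⊆ π̃`). [cite: GeorgiiHiguchi2000, Lemma 3.4 (proof)] -/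
theorem exists_starWalk_boundary_level_one (F : Finset (Site 2)) (M : Set (Site 2))
    (hFH : ∀ z ∈ F, 1 ≤ z 1) (hF1 : ∃ z ∈ F, z 1 = 1)
    (hconn : ∀ u ∈ F, ∀ v ∈ F, ∃ q : (zdGraph 2).Walk u v, ∀ z ∈ q.support, z ∈ F)
    (hclosed : ∀ v : Site 2, 1 ≤ v 1 → v ∉ F → (∃ c ∈ F, (zdGraph 2).Adj v c) → v ∈ M)
    {a b : ℤ}
    (ha0 : ∀ t ≤ a, (![t, 1] : Site 2) ∉ F) (ha1 : ∀ t < a, (![t, 2] : Site 2) ∉ F)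
    (ha : ∃ c ∈ F, (zdGraph 2).Adj (![a, 1] : Site 2) c)
    (hb0 : ∀ t, b ≤ t → (![t, 1] : Site 2) ∉ F) (hb1 : ∀ t, b < t → (![t, 2] : Site 2) ∉ F)
    (hb : ∃ c ∈ F, (zdGraph 2).Adj (![b, 1] : Site 2) c) :
    ∃ q : zdStarGraph.Walk (![a, 1] : Site 2) ![b, 1], ∀ v ∈ q.support, 1 ≤ v 1 ∧ v ∉ F ∧ v ∈ M := by
  classical
  set e : Site 2 := Pi.single 1 1 with he
  have he0 : e 0 = 0 := by simp [he]
  have he1 : e 1 = 1 := by simp [he]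
  set F₀ : Finset (Site 2) := F.image (fun y => y - e) with hF₀
  have hmem₀ : ∀ z, z ∈ F₀ ↔ z + e ∈ F := fun z => mem_image_sub_iff F e z
  have hpt0 : ∀ t : ℤ, (![t, 0] : Site 2) + e = ![t, 1] := fun t => by
    rw [Site.eq_iff_two]; simp [he0, he1]
  have hpt1 : ∀ t : ℤ, (![t, 1] : Site 2) + e = ![t, 2] := fun t => by
    rw [Site.eq_iff_two]; simp [he0, he1]
  have hadj_shift : ∀ u v : Site 2, (zdGraph 2).Adj (u + e) (v + e) ↔ (zdGraph 2).Adj u v :=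
    fun u v => (zdShiftIso (d := 2) e).map_adj_iff
  obtain ⟨q, hq⟩ := exists_starWalk_boundary_halfPlane F₀ {v | v + e ∈ M}
    (fun z hz => by have := hFH _ ((hmem₀ z).1 hz); simp [he1] at this; omega)
    (by obtain ⟨z, hz, hz1⟩ := hF1
        exact ⟨z - e, (hmem₀ _).2 (by rwa [sub_add_cancel]), by simp [he1, hz1]⟩)
    (by intro u hu v hv
        obtain ⟨p, hp⟩ := hconn _ ((hmem₀ u).1 hu) _ ((hmem₀ v).1 hv)
        refine ⟨(p.map (zdShiftIso (d := 2) (-e)).toRelEmbedding.toRelHom).copy (by simp) (by simp),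
          fun z hz => ?_⟩
        rw [Walk.support_copy, Walk.support_map, List.mem_map] at hz
        obtain ⟨y, hy, rfl⟩ := hz
        refine (hmem₀ _).2 ?_
        simpa using hp y hy)
    (by rintro v hv1 hvF ⟨c, hc, hvc⟩
        refine hclosed (v + e) (by simp [he1]; omega) (fun h => hvF ((hmem₀ v).2 h))
          ⟨c + e, (hmem₀ c).1 hc, (hadj_shift v c).2 hvc⟩)
    (a := a) (b := b)
    (fun t ht h => ha0 t ht (by rw [← hpt0]; exact (hmem₀ _).1 h))
    (fun t ht h => ha1 t ht (by have := (hmem₀ _).1 h; rwa [hpt1] at this))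
    (by obtain ⟨c, hc, hac⟩ := ha
        refine ⟨c - e, (hmem₀ _).2 (by rwa [sub_add_cancel]), ?_⟩
        rw [← hadj_shift, sub_add_cancel, hpt0]; exact hac)
    (fun t ht h => hb0 t ht (by rw [← hpt0]; exact (hmem₀ _).1 h))
    (fun t ht h => hb1 t ht (by have := (hmem₀ _).1 h; rwa [hpt1] at this))
    (by obtain ⟨c, hc, hbc⟩ := hb
        refine ⟨c - e, (hmem₀ _).2 (by rwa [sub_add_cancel]), ?_⟩
        rw [← hadj_shift, sub_add_cancel, hpt0]; exact hbc)
  obtain ⟨w, hw⟩ := exists_starWalk_shift e ⟨q, hq⟩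
  refine ⟨w.copy (hpt0 a) (hpt0 b), fun v hv => ?_⟩
  rw [Walk.support_copy] at hv
  obtain ⟨h1, h2, h3⟩ := hw v hv
  refine ⟨?_, fun h => h2 ((hmem₀ _).2 (by rwa [sub_add_cancel])), by simpa using h3⟩
  simp [he1] at h1; omega

/-- **A `-∗`semicircuit of `π_up` around a box kills the `+`clusters of the box** ("the box
`[-n, n] × [0, n - 1]` is surrounded by a `-∗`semicircuit in `π_up` … which implies that
`μ(E⁺_up) = 0`"): eye/band lemma with the semicircuit and its mirror image. [cite: GeorgiiHiguchi2000, Lemma 3.4 (proof)] -/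
theorem siteCluster_finite_of_minusStarWalk {ω : SpinConfig (Site 2)} {n : ℕ} {a b : ℤ}
    (ha : a < -(n : ℤ)) (hb : (n : ℤ) < b)
    (α : zdStarGraph.Walk (![a, 0] : Site 2) ![b, 0])
    (hα : ∀ z ∈ α.support, 0 ≤ z 1 ∧ ω z = -1 ∧ ¬ (-(n : ℤ) ≤ z 0 ∧ z 0 ≤ n ∧ z 1 ≤ (n : ℤ) + 1))
    {u : Site 2} (hu : -(n : ℤ) ≤ u 0 ∧ u 0 ≤ n ∧ 0 ≤ u 1 ∧ u 1 ≤ (n : ℤ) + 1) :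
    (siteCluster (zdGraph 2) (spinSites 1 ω ∩ halfPlane 0) u).Finite := by
  classical
  by_contra hinf
  rw [Set.not_finite] at hinf  -- `Set.Infinite`
  obtain ⟨α', hα'⟩ := exists_reflected_starWalk α
  have hcast : ((n + 1 : ℕ) : ℤ) = (n : ℤ) + 1 := by push_cast; ring
  -- a box containing both walks, and a cluster site outside it
  obtain ⟨H, hH⟩ := (eventually_subset_box_holds (d := 2) (α.support.toFinset ∪ α'.support.toFinset)).exists
  obtain ⟨w, hw, hwH⟩ := hinf.exists_notMem_finset (box 2 H)
  have huO : u ∈ spinSites 1 ω ∩ halfPlane 0 := hw.1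
  have hu_mem : u ∈ siteCluster (zdGraph 2) (spinSites 1 ω ∩ halfPlane 0) u :=
    (mem_siteCluster_self_iff _ _ _).2 huO
  obtain ⟨β, hβ⟩ := exists_walk_of_mem_siteCluster hu_mem hw
  obtain ⟨z, hzβ, hz⟩ := exists_mem_support_of_bandSemicircuits (m := n + 1) (c₁ := -(n : ℤ)) (c₂ := n)
    ha hb (xL := ![a, 0]) (xR := ![b, 0]) (by simp) (by simp) (by simp) (by simp)
    α (fun z hz h => (hα z hz).2.2 (by rw [hcast] at h; exact h))
    α' (fun z hz h => by
      have h' := (hα _ ((hα' z).1 hz)).2.2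
      have hR0 : (reflectCoord (d := 2) 1 z) 0 = z 0 := Rf_apply_zero z
      have hR1 : (reflectCoord (d := 2) 1 z) 1 = -z 1 := Rf_apply_one z
      rw [hR0, hR1] at h'
      rw [hcast] at h
      exact h' ⟨h.1, h.2.1, by linarith [h.2.2]⟩)
    (H := H) (fun z hz => hH (Finset.mem_union_left _ (List.mem_toFinset.2 hz)))
    (fun z hz => hH (Finset.mem_union_right _ (List.mem_toFinset.2 hz)))
    (u := u) (w := w) ⟨hu.1, hu.2.1, by rw [hcast]; linarith [hu.2.2.1], by rw [hcast]; exact hu.2.2.2⟩ hwH β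
  have hzO := hβ z hzβ
  rcases hz with hz | hz
  · have := (hα z hz).2.1
    rw [hzO.1] at this
    exact absurd this (by decide)
  · have hz' := hα _ ((hα' z).1 hz)
    have hR1 : (reflectCoord (d := 2) 1 z) 1 = -z 1 := Rf_apply_one z
    have hz0 : z 1 = 0 := by
      have h1 := hz'.1
      have h2 : 0 ≤ z 1 := hzO.2
      rw [hR1] at h1
      omega
    have hRz : reflectCoord (d := 2) 1 z = z := reflectCoord_one_eq_self_of_apply_one hz0
    rw [hRz] at hz'
    have := hz'.2.1
    rw [hzO.1] at this
    exact absurd this (by decide)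

end Geometry

end Literature.Probability.LatticeModels
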